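import Summits.BirchSwinnertonDyer.BirchSwinnertonDyer.Theorems.AlignedTransportAtTwoMainConjectureTransportAlignedAtTwoDeltaPosJacobianLevel
import HarnessLib

/-!
# Crux C1 `MainConjectureTransportAlignedAtTwo` (stmt-BirchSwinnertonDyer-22296), line `birth`, residual (R2) `stub_lamLawKilford`:
# THE GALOIS HALF-TRANSPORT WITHOUT BUZZARD — two `Γ_ℚ`-equivariant parametrisation maps `Φᵢ : J₀(L) → Wᵢ(ℂ)` of an `S₃` pair sharing a
# cubic field, whose half-class kernels are NESTED, transport half-classes through THE equivariant isomorphism (width seat att-p4 g14;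
# `--supports 22296`)

THEOREMS ONLY (no `def`, no named fact, no `sorry`). BSD is not proved by this; C1 is not closed by this; `stub_lamLawKilford` is NOT discharged by
this.

WHY. In att-p3 g14's `…DeltaPosJacobianLevel.half_transport_of_abstract` (p669108) the PRINT Hecke pair {`heckeSelfDual_torsionBy_J0`,
`buzzard2000_multiplicityOne_gamma0`}, the off-stratum binder `Δ(W₁) ∉ ℚ₂²`, the newform / depleted-level bookkeeping (`f₁`, `S`, `L` odd,
`N₁·∏ℓ² ∣ L`, good reduction off `2L`) and the Hecke-kernel relations `hTᵢ hUᵢ` are consumed at EXACTLY ONE point: att-p4 g11's (K4)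
`…BuzzardKFour.fourCosets_of_dvd_S3`, giving «the COMMON kernel `ker θ₁ ⊓ ker θ₂` of the two half-maps `θᵢ : Λ_L → Wᵢ[2]` has at most four cosets»
— i.e. (both `θᵢ` being onto) `ker θ₁ = ker θ₂`: the two `ρ̄`-planes cut out in `Λ_L/𝔪₀Λ_L` COINCIDE. Off the Kilford stratum this is multiplicity one;
ON the stratum (`Δ(W₁) ∈ ℚ₂²`, `ρ̄|_{D₂}` trivial, `J₀(L)[𝔪₀] ≅ ρ̄ ⊕ ρ̄`, Kilford–Wiese) it is a genuine condition — the «selection of the plane» named in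
the docstring of `stub_lamLawKilford`. This file runs the SAME argument with that condition as the hypothesis, in its weakest form

  `hker : ∀ x ∈ Λ_L, Φ₁ [x/2] = 0 → Φ₂ [x/2] = 0`   (kernel inclusion; `= ` equality since both maps are onto `Wᵢ[2]`),

and with NO Hecke algebra, NO Buzzard, NO sign or stratum condition, `W₁` not even globally minimal:

* `half_transport_of_kernel_le` — for every `x ∈ Λ_L` and `P₁ ∈ W₁[2](ℚ̄)` with `Φ₁ [x/2] = ι P₁`: `Φ₂ [x/2] = ι (e P₁)` for THE `Γ_ℚ`-equivariant
  `e : W₁[2] ≃+ W₂[2]` (proof = p669108's, with `ker θ₁` in place of the four-coset subgroup: `[Λ_L : ker θ₁] = #W₁[2] = 4` by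
  `…DeltaPosGaloisPlane.surjective_of_equivariant_of_exists_ne_zero`, then `…DeltaPosGaloisPlane.comp_eq_of_sharedCubicField`);
* `half_transport_link_of_kernel_le` — the same in the link currency of `…DeltaPosParityLinkDepleted.even_depletedPlusValue_iff_of_link`.

So on the Kilford stratum the (G4) Galois half reduces to `hker` ALONE; `…KilfordPlaneCongruence` (this seat) feeds it to the `Δ > 0` capstone.
Finite-flat reading of `hker` versus `AlignedAtTwo` (the crux's binder): crux workfile `KILFORD-PLANE-att-p4-g14.md`.

References: Darmon–Diamond–Taylor 1995 §1.5, §1.7 [DarmonDiamondTaylor1995]; Kilford–Wiese 2008 Thm. 1.2 [KilfordWiese2008]; Silverman AEC III.§7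
[SilvermanAEC2009].
-/

noncomputable section

-- justification: the `Summit.BirchSwinnertonDyer.BirchSwinnertonDyer.…` path repeats a component (route-file convention)
set_option linter.dupNamespace false
set_option autoImplicit false

open scoped MatrixGroups ModularForm NumberField Classical
open CongruenceSubgroup Complex WeierstrassCurve IsDedekindDomain Polynomial Module
open Literature.NumberTheory.EllipticCurves Literature.NumberTheory.EllipticCurves.ModularForms
open Literature.NumberTheory.EllipticCurves.Greenberg1999
open Summit.BirchSwinnertonDyer.Rank1Residual.F1Sign2
open Summit.BirchSwinnertonDyer.BirchSwinnertonDyer.Theorems.AlignedTransportAtTwoDeltaPosGaloisPlane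
open Summit.BirchSwinnertonDyer.BirchSwinnertonDyer.Theorems.AlignedTransportAtTwoSharedCubicTorsion
open Summit.BirchSwinnertonDyer.BirchSwinnertonDyer.Theorems.AlignedTransportAtTwoDeltaPosJacobian
open Summit.BirchSwinnertonDyer.BirchSwinnertonDyer.Theorems.AlignedTransportAtTwoDeltaPosJacobianLevel

namespace Summit.BirchSwinnertonDyer.BirchSwinnertonDyer.Theorems.AlignedTransportAtTwoKilfordPlaneTransport

section Transport

variable {L : ℕ} [NeZero L] (ι : AlgebraicClosure ℚ →+* ℂ)

/-- **THE GALOIS HALF-TRANSPORT WITHOUT BUZZARD (Kilford-capable (G4), Galois half).** Two additive maps `Φᵢ : J₀(L) → Wᵢ(ℂ)` on an `S₃` pair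
sharing a cubic field (`[F:ℚ] = 3`, roots `r₁ r₂` of the two `2`-division cubics, no rational `2`-torsion abscissa, `Δ(W₂) ∉ ℚ²`), `Γ_ℚ`-equivariant on
torsion for a common abstract action `gal` (`hgalᵢ`), both non-zero on some half-class (`hnzᵢ`), with NESTED half-class kernels (`hker`): for every
`x ∈ Λ_L = H₁(X₀(L);ℤ)` and `P₁ ∈ W₁[2](ℚ̄)` with `Φ₁ [x/2] = ι P₁`, **`Φ₂ [x/2] = ι (e P₁)`** for THE `Γ_ℚ`-equivariant `e : W₁[2] ≃+ W₂[2]`.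
No Hecke operators, no multiplicity one, no sign of `Δ`, no stratum condition. [cite: DarmonDiamondTaylor1995, §1.5 and §1.7]
[cite: SilvermanAEC2009, III.§7] -/
theorem half_transport_of_kernel_le
    {W₁ W₂ : WeierstrassCurve ℚ} [W₁.IsElliptic] [W₂.IsElliptic]
    (ht₁ : ∀ x : ℚ, ¬ HasRationalTwoTorsionX W₁ x) (ht₂ : ∀ x : ℚ, ¬ HasRationalTwoTorsionX W₂ x) (hΔ₂ : ¬ IsSquare W₂.Δ)
    {F : Type*} [Field F] [Algebra ℚ F] [FiniteDimensional ℚ F] (hF : finrank ℚ F = 3)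
    {r₁ r₂ : F} (hr₁ : aeval r₁ (twoDivisionUCubic W₁) = 0) (hr₂ : aeval r₂ (twoDivisionUCubic W₂) = 0)
    (Φ₁ : J0 L →+ (W₁.baseChange ℂ).toAffine.Point) (Φ₂ : J0 L →+ (W₂.baseChange ℂ).toAffine.Point)
    (gal : Field.absoluteGaloisGroup ℚ → (J0.tors L →+ J0.tors L))
    (hgal₁ : ∀ (σ : Field.absoluteGaloisGroup ℚ) (y : J0.tors L) (P : W₁.geomPoints),
      Φ₁ (y : J0 L) = W₁.geomPointsToComplex ι P → Φ₁ ((gal σ y : J0.tors L) : J0 L) = W₁.geomPointsToComplex ι (σ • P))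
    (hgal₂ : ∀ (σ : Field.absoluteGaloisGroup ℚ) (y : J0.tors L) (P : W₂.geomPoints),
      Φ₂ (y : J0 L) = W₂.geomPointsToComplex ι P → Φ₂ ((gal σ y : J0.tors L) : J0 L) = W₂.geomPointsToComplex ι (σ • P))
    (hnz₁ : ∃ x ∈ periodHomology L, Φ₁ (Submodule.Quotient.mk ((2 : ℂ)⁻¹ • x)) ≠ 0)
    (hnz₂ : ∃ x ∈ periodHomology L, Φ₂ (Submodule.Quotient.mk ((2 : ℂ)⁻¹ • x)) ≠ 0)
    (hker : ∀ x ∈ periodHomology L,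
      Φ₁ (Submodule.Quotient.mk ((2 : ℂ)⁻¹ • x)) = 0 → Φ₂ (Submodule.Quotient.mk ((2 : ℂ)⁻¹ • x)) = 0)
    (e : geomTorsion W₁ (2 : ℤ) ≃+ geomTorsion W₂ (2 : ℤ))
    (he : ∀ (σ : Field.absoluteGaloisGroup ℚ) (P : geomTorsion W₁ (2 : ℤ)), e (σ • P) = σ • e P)
    {x : Module.Dual ℂ (CuspForm (Gamma0 L) 2)} (hx : x ∈ periodHomology L) {P₁ : geomTorsion W₁ (2 : ℤ)}
    (hP₁ : Φ₁ (Submodule.Quotient.mk ((2 : ℂ)⁻¹ • x)) = W₁.geomPointsToComplex ι (P₁ : W₁.geomPoints)) :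
    Φ₂ (Submodule.Quotient.mk ((2 : ℂ)⁻¹ • x)) = W₂.geomPointsToComplex ι ((e P₁ : geomTorsion W₂ (2 : ℤ)) : W₂.geomPoints) := by
  -- notation
  set Λ := periodHomology L with hΛ
  let half : Module.Dual ℂ (CuspForm (Gamma0 L) 2) → J0 L := fun z ↦ Submodule.Quotient.mk ((2 : ℂ)⁻¹ • z)
  have half_add : ∀ z z', half (z + z') = half z + half z' := fun z z' ↦ by
    simp only [half, smul_add, Submodule.Quotient.mk_add]
  -- the maps `θᵢ : Λ → Wᵢ[2]` through `existsUnique_geomTorsion_eq`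
  have hex₁ : ∀ z : Λ, ∃! P : geomTorsion W₁ (2 : ℤ), W₁.geomPointsToComplex ι (P : W₁.geomPoints) = Φ₁ (half z) :=
    fun z ↦ existsUnique_geomTorsion_eq W₁ ι (apply_half_add_self Φ₁ z.2)
  have hex₂ : ∀ z : Λ, ∃! P : geomTorsion W₂ (2 : ℤ), W₂.geomPointsToComplex ι (P : W₂.geomPoints) = Φ₂ (half z) :=
    fun z ↦ existsUnique_geomTorsion_eq W₂ ι (apply_half_add_self Φ₂ z.2)
  choose θ₁f hθ₁f using fun z ↦ (hex₁ z).exists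
  choose θ₂f hθ₂f using fun z ↦ (hex₂ z).exists
  have uniq₁ : ∀ (z : Λ) (P : geomTorsion W₁ (2 : ℤ)), W₁.geomPointsToComplex ι (P : W₁.geomPoints) = Φ₁ (half z) → P = θ₁f z :=
    fun z P hP ↦ (hex₁ z).unique hP (hθ₁f z)
  have uniq₂ : ∀ (z : Λ) (P : geomTorsion W₂ (2 : ℤ)), W₂.geomPointsToComplex ι (P : W₂.geomPoints) = Φ₂ (half z) → P = θ₂f z :=
    fun z P hP ↦ (hex₂ z).unique hP (hθ₂f z)
  let θ₁ : Λ →+ geomTorsion W₁ (2 : ℤ) :=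
    { toFun := θ₁f
      map_zero' := by
        symm; apply uniq₁
        have h0 : half 0 = 0 := by simp only [half, smul_zero, Submodule.Quotient.mk_zero]
        rw [ZeroMemClass.coe_zero, map_zero, ZeroMemClass.coe_zero, h0, map_zero]
      map_add' := fun z z' ↦ by
        symm; apply uniq₁
        rw [AddSubgroup.coe_add, map_add, hθ₁f, hθ₁f, AddSubgroup.coe_add, half_add, map_add] }
  let θ₂ : Λ →+ geomTorsion W₂ (2 : ℤ) :=
    { toFun := θ₂f
      map_zero' := by
        symm; apply uniq₂
        have h0 : half 0 = 0 := by simp only [half, smul_zero, Submodule.Quotient.mk_zero]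
        rw [ZeroMemClass.coe_zero, map_zero, ZeroMemClass.coe_zero, h0, map_zero]
      map_add' := fun z z' ↦ by
        symm; apply uniq₂
        rw [AddSubgroup.coe_add, map_add, hθ₂f, hθ₂f, AddSubgroup.coe_add, half_add, map_add] }
  have hθ₁_apply : ∀ z, θ₁ z = θ₁f z := fun _ ↦ rfl
  have hθ₂_apply : ∀ z, θ₂ z = θ₂f z := fun _ ↦ rfl
  -- the torsion points `⟨half z⟩ ∈ J0.tors L` and the lifted Galois action on `Λ`
  have htors : ∀ z : Λ, half z ∈ J0.tors L := fun z ↦ by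
    rw [J0.mem_tors_iff, isOfFinAddOrder_iff_nsmul_eq_zero]
    exact ⟨2, two_pos, by rw [two_nsmul]; exact half_add_half_eq_zero z.2⟩
  have hlift : ∀ (σ : Field.absoluteGaloisGroup ℚ) (z : Λ), ∃ z' : Λ,
      half z' = ((gal σ ⟨half z, htors z⟩ : J0.tors L) : J0 L) := by
    intro σ z
    set t : J0.tors L := gal σ ⟨half z, htors z⟩ with ht
    have htt : (t : J0 L) + (t : J0 L) = 0 := by
      rw [← Submodule.coe_add, ht, ← map_add]
      have : (⟨half z, htors z⟩ : J0.tors L) + ⟨half z, htors z⟩ = 0 := Subtype.ext (half_add_half_eq_zero z.2)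
      rw [this, map_zero, Submodule.coe_zero]
    obtain ⟨z', hz', hz'eq⟩ := exists_half_eq htt
    exact ⟨⟨z', hz'⟩, hz'eq⟩
  choose act hact using hlift
  -- equivariance
  have hθ₁ : ∀ (σ : Field.absoluteGaloisGroup ℚ) (z : Λ), θ₁ (act σ z) = σ • θ₁ z := by
    intro σ z
    symm
    rw [hθ₁_apply, hθ₁_apply]
    apply uniq₁
    rw [AddSubgroup.torsionBy.coe_smul, hact σ z]
    exact (hgal₁ σ ⟨half z, htors z⟩ (θ₁f z : W₁.geomPoints) (hθ₁f z).symm).symm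
  have hθ₂ : ∀ (σ : Field.absoluteGaloisGroup ℚ) (z : Λ), θ₂ (act σ z) = σ • θ₂ z := by
    intro σ z
    symm
    rw [hθ₂_apply, hθ₂_apply]
    apply uniq₂
    rw [AddSubgroup.torsionBy.coe_smul, hact σ z]
    exact (hgal₂ σ ⟨half z, htors z⟩ (θ₂f z : W₂.geomPoints) (hθ₂f z).symm).symm
  -- non-vanishing
  have h0 : ∀ {W' : WeierstrassCurve ℚ} [W'.IsElliptic] (Φ' : J0 L →+ (W'.baseChange ℂ).toAffine.Point)
      (θf : Λ → geomTorsion W' (2 : ℤ))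
      (hθf : ∀ z, W'.geomPointsToComplex ι (θf z : W'.geomPoints) = Φ' (half z))
      (hnz : ∃ z ∈ periodHomology L, Φ' (Submodule.Quotient.mk ((2 : ℂ)⁻¹ • z)) ≠ 0), ∃ z, θf z ≠ 0 := by
    intro W' _ Φ' θf hθf hnz
    obtain ⟨z, hz, hne⟩ := hnz
    refine ⟨⟨z, hz⟩, fun h0 ↦ hne ?_⟩
    have := hθf ⟨z, hz⟩
    rw [h0, ZeroMemClass.coe_zero, map_zero] at this
    exact this.symm
  have h0₁ : ∃ z, θ₁ z ≠ 0 := h0 Φ₁ θ₁f hθ₁f hnz₁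
  have h0₂ : ∃ z, θ₂ z ≠ 0 := h0 Φ₂ θ₂f hθ₂f hnz₂
  -- the kernel of `θ₁`: index `4` (onto `W₁[2]`), contained in the kernel of `θ₂` by `hker`
  set K : AddSubgroup Λ := θ₁.ker with hK
  have hsurj₁ : Function.Surjective θ₁ := surjective_of_equivariant_of_exists_ne_zero ht₁ act θ₁ hθ₁ h0₁
  have hKidx : K.index = 4 := by
    rw [hK, AddSubgroup.index_ker, AddMonoidHom.range_eq_top.mpr hsurj₁, AddSubgroup.card_top]
    exact WeierstrassCurve.natCard_geomTorsion_two W₁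
  have hK₁ : K ≤ θ₁.ker := le_rfl
  have hK₂ : K ≤ θ₂.ker := by
    intro z hz
    rw [hK, AddMonoidHom.mem_ker, hθ₁_apply] at hz
    rw [AddMonoidHom.mem_ker, hθ₂_apply]
    have h1 : Φ₁ (half (z : Module.Dual ℂ (CuspForm (Gamma0 L) 2))) = 0 := by
      rw [← hθ₁f z, hz, ZeroMemClass.coe_zero, map_zero]
    have h2 : Φ₂ (half (z : Module.Dual ℂ (CuspForm (Gamma0 L) 2))) = 0 := hker z z.2 h1
    symm; apply uniq₂
    rw [ZeroMemClass.coe_zero, map_zero]; exact h2.symm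
  -- the factorisation through THE equivariant isomorphism
  have hcomp := comp_eq_of_sharedCubicField (W₁ := W₁) (W₂ := W₂) hF ht₁ ht₂ hΔ₂ hr₁ hr₂ act θ₁ θ₂ hθ₁ hθ₂ h0₁ h0₂
    K hK₁ hK₂ (by rw [hKidx]; norm_num) (by rw [hKidx]) e he
  -- conclude at `x`
  have hP₁' : P₁ = θ₁f ⟨x, hx⟩ := uniq₁ ⟨x, hx⟩ P₁ hP₁.symm
  have := hθ₂f ⟨x, hx⟩
  rw [← hθ₂_apply, hcomp ⟨x, hx⟩, hθ₁_apply, ← hP₁'] at this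
  exact this.symm

/-- **The kernel-inclusion hypothesis is symmetric** (under the hypotheses of `half_transport_of_kernel_le`): the half-class kernel of `Φ₂` is
contained in that of `Φ₁` as well — both kernels are THE `ρ̄`-plane `ker θ₁ = ker θ₂`. [cite: SilvermanAEC2009, III.§7] -/
theorem kernel_le_symm_of_kernel_le
    {W₁ W₂ : WeierstrassCurve ℚ} [W₁.IsElliptic] [W₂.IsElliptic]
    (ht₁ : ∀ x : ℚ, ¬ HasRationalTwoTorsionX W₁ x) (ht₂ : ∀ x : ℚ, ¬ HasRationalTwoTorsionX W₂ x) (hΔ₂ : ¬ IsSquare W₂.Δ)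
    {F : Type*} [Field F] [Algebra ℚ F] [FiniteDimensional ℚ F] (hF : finrank ℚ F = 3)
    {r₁ r₂ : F} (hr₁ : aeval r₁ (twoDivisionUCubic W₁) = 0) (hr₂ : aeval r₂ (twoDivisionUCubic W₂) = 0)
    (Φ₁ : J0 L →+ (W₁.baseChange ℂ).toAffine.Point) (Φ₂ : J0 L →+ (W₂.baseChange ℂ).toAffine.Point)
    (gal : Field.absoluteGaloisGroup ℚ → (J0.tors L →+ J0.tors L))
    (hgal₁ : ∀ (σ : Field.absoluteGaloisGroup ℚ) (y : J0.tors L) (P : W₁.geomPoints),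
      Φ₁ (y : J0 L) = W₁.geomPointsToComplex ι P → Φ₁ ((gal σ y : J0.tors L) : J0 L) = W₁.geomPointsToComplex ι (σ • P))
    (hgal₂ : ∀ (σ : Field.absoluteGaloisGroup ℚ) (y : J0.tors L) (P : W₂.geomPoints),
      Φ₂ (y : J0 L) = W₂.geomPointsToComplex ι P → Φ₂ ((gal σ y : J0.tors L) : J0 L) = W₂.geomPointsToComplex ι (σ • P))
    (hnz₁ : ∃ x ∈ periodHomology L, Φ₁ (Submodule.Quotient.mk ((2 : ℂ)⁻¹ • x)) ≠ 0)
    (hnz₂ : ∃ x ∈ periodHomology L, Φ₂ (Submodule.Quotient.mk ((2 : ℂ)⁻¹ • x)) ≠ 0)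
    (hker : ∀ x ∈ periodHomology L,
      Φ₁ (Submodule.Quotient.mk ((2 : ℂ)⁻¹ • x)) = 0 → Φ₂ (Submodule.Quotient.mk ((2 : ℂ)⁻¹ • x)) = 0)
    {x : Module.Dual ℂ (CuspForm (Gamma0 L) 2)} (hx : x ∈ periodHomology L)
    (h2 : Φ₂ (Submodule.Quotient.mk ((2 : ℂ)⁻¹ • x)) = 0) :
    Φ₁ (Submodule.Quotient.mk ((2 : ℂ)⁻¹ • x)) = 0 := by
  obtain ⟨e, he⟩ := exists_equivariant_addEquiv_of_sharedCubicField W₁ W₂ hF ht₁ ht₂ hr₁ hr₂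
  obtain ⟨P₁, hP₁, -⟩ := existsUnique_geomTorsion_eq W₁ ι (apply_half_add_self Φ₁ hx)
  have h := half_transport_of_kernel_le ι ht₁ ht₂ hΔ₂ hF hr₁ hr₂ Φ₁ Φ₂ gal hgal₁ hgal₂ hnz₁ hnz₂ hker e he hx hP₁.symm
  have huniq := existsUnique_geomTorsion_eq W₂ ι (apply_half_add_self Φ₂ hx)
  have he0 : e P₁ = 0 := by
    refine huniq.unique h.symm ?_
    rw [h2, ZeroMemClass.coe_zero, map_zero]
  have hP0 : P₁ = 0 := by simpa using he0
  rw [← hP₁, hP0, ZeroMemClass.coe_zero, map_zero]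

/-- **THE GALOIS HALF-TRANSPORT WITHOUT BUZZARD, in link currency.** Under the hypotheses of `half_transport_of_kernel_le` and with the maps
`Φᵢ` reading on half-classes as `Φᵢ [x/2] = uᵢ(cᵢ·D_S·x(gᵢ)/2)` for parametrisation data `Dᵢ` and forms `gᵢ` at level `L` (hypotheses `hΦ₁ hΦ₂`),
every `x ∈ Λ_L` carries the link `∃ P, ι P = u₁(c₁·D_S·x(g₁)/2) ∧ ι (e P) = u₂(c₂·D_S·x(g₂)/2)` — the hypothesis `hlink` of
`…DeltaPosParityLinkDepleted.even_depletedPlusValue_iff_of_link`. No Hecke operators, no multiplicity one, no stratum condition.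
[cite: DarmonDiamondTaylor1995, §1.5 and §1.7] -/
theorem half_transport_link_of_kernel_le
    {W₁ W₂ : WeierstrassCurve ℚ} [W₁.IsElliptic] [W₂.IsElliptic]
    (ht₁ : ∀ x : ℚ, ¬ HasRationalTwoTorsionX W₁ x) (ht₂ : ∀ x : ℚ, ¬ HasRationalTwoTorsionX W₂ x) (hΔ₂ : ¬ IsSquare W₂.Δ)
    {N₁ N₂ : ℕ} [NeZero N₁] [NeZero N₂] (D₁ : ModularParametrizationData W₁ N₁) (D₂ : ModularParametrizationData W₂ N₂)
    (S : Finset ℕ)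
    {F : Type*} [Field F] [Algebra ℚ F] [FiniteDimensional ℚ F] (hF : finrank ℚ F = 3)
    {r₁ r₂ : F} (hr₁ : aeval r₁ (twoDivisionUCubic W₁) = 0) (hr₂ : aeval r₂ (twoDivisionUCubic W₂) = 0)
    (g₁ g₂ : CuspForm (Gamma0 L) 2)
    (Φ₁ : J0 L →+ (W₁.baseChange ℂ).toAffine.Point) (Φ₂ : J0 L →+ (W₂.baseChange ℂ).toAffine.Point)
    (hΦ₁ : ∀ x ∈ periodHomology L, Φ₁ (Submodule.Quotient.mk ((2 : ℂ)⁻¹ • x)) =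
      D₁.uniformize ((D₁.c : ℂ) * (((∏ ℓ ∈ S, ℓ ^ 2 : ℕ) : ℂ) * x g₁) / 2))
    (hΦ₂ : ∀ x ∈ periodHomology L, Φ₂ (Submodule.Quotient.mk ((2 : ℂ)⁻¹ • x)) =
      D₂.uniformize ((D₂.c : ℂ) * (((∏ ℓ ∈ S, ℓ ^ 2 : ℕ) : ℂ) * x g₂) / 2))
    (gal : Field.absoluteGaloisGroup ℚ → (J0.tors L →+ J0.tors L))
    (hgal₁ : ∀ (σ : Field.absoluteGaloisGroup ℚ) (y : J0.tors L) (P : W₁.geomPoints),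
      Φ₁ (y : J0 L) = W₁.geomPointsToComplex ι P → Φ₁ ((gal σ y : J0.tors L) : J0 L) = W₁.geomPointsToComplex ι (σ • P))
    (hgal₂ : ∀ (σ : Field.absoluteGaloisGroup ℚ) (y : J0.tors L) (P : W₂.geomPoints),
      Φ₂ (y : J0 L) = W₂.geomPointsToComplex ι P → Φ₂ ((gal σ y : J0.tors L) : J0 L) = W₂.geomPointsToComplex ι (σ • P))
    (hnz₁ : ∃ x ∈ periodHomology L, Φ₁ (Submodule.Quotient.mk ((2 : ℂ)⁻¹ • x)) ≠ 0)
    (hnz₂ : ∃ x ∈ periodHomology L, Φ₂ (Submodule.Quotient.mk ((2 : ℂ)⁻¹ • x)) ≠ 0)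
    (hker : ∀ x ∈ periodHomology L,
      Φ₁ (Submodule.Quotient.mk ((2 : ℂ)⁻¹ • x)) = 0 → Φ₂ (Submodule.Quotient.mk ((2 : ℂ)⁻¹ • x)) = 0)
    (e : geomTorsion W₁ (2 : ℤ) ≃+ geomTorsion W₂ (2 : ℤ))
    (he : ∀ (σ : Field.absoluteGaloisGroup ℚ) (P : geomTorsion W₁ (2 : ℤ)), e (σ • P) = σ • e P)
    {x : Module.Dual ℂ (CuspForm (Gamma0 L) 2)} (hx : x ∈ periodHomology L) :
    ∃ P : geomTorsion W₁ (2 : ℤ),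
      W₁.geomPointsToComplex ι (P : geomPoints W₁) = D₁.uniformize ((D₁.c : ℂ) * (((∏ ℓ ∈ S, ℓ ^ 2 : ℕ) : ℂ) * x g₁) / 2) ∧
      W₂.geomPointsToComplex ι (e P : geomPoints W₂) = D₂.uniformize ((D₂.c : ℂ) * (((∏ ℓ ∈ S, ℓ ^ 2 : ℕ) : ℂ) * x g₂) / 2) := by
  obtain ⟨P₁, hP₁, -⟩ := existsUnique_geomTorsion_eq W₁ ι (apply_half_add_self Φ₁ hx)
  refine ⟨P₁, by rw [hP₁, hΦ₁ x hx], ?_⟩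
  rw [← hΦ₂ x hx]
  exact (half_transport_of_kernel_le ι ht₁ ht₂ hΔ₂ hF hr₁ hr₂ Φ₁ Φ₂ gal hgal₁ hgal₂ hnz₁ hnz₂ hker e he hx hP₁.symm).symm

end Transport

end Summit.BirchSwinnertonDyer.BirchSwinnertonDyer.Theorems.AlignedTransportAtTwoKilfordPlaneTransport

end
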